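import Summits.Ventures.PercRepro.Night2FatZThreeB
import Summits.Ventures.PercRepro.Night2FatDegSingle

/-!
# night-2: the witnesses of the singly degenerate regime at small `N` — side points, free points, unloaded singletons — the case |P₂| = 3

**`exists_small_witnesses_deg`**: for every lossy basis pair of the singly degenerate regime there are sets `U` of side
points, `V` of free points and `E` of points on no non-class basis line (unloaded singletons) of `W ∖ {x}` in one of
four patterns: (α) the line of `M` is not a non-class basis line, `|U| = 2`, `|V| = 1`, `|E| ≥ 2`;
(β) `|U| = 1`, `|V| = 3`, `|E| ≥ 2`; (γ) `|U| = 2`, `|V| = 2`, `|E| ≥ 1`; (δ) `|U| = 1`, `|V| = 2`, `|E| ≥ 3`.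
Each pattern gives the fair share at `N = 6, 7, 8` (`Night2FatDegNumIccA/B`).  The case analysis follows
`exists_side_and_free_deg`: `|P₂| ∈ {0, 1, 2, 3}` basis points of `π₂` off the spine.
Paper `proofs/NIGHT-2-g35.md` §5.
-/

namespace PercRepro.Shadow

open PercRepro.ThmH PercRepro.PerFlat

variable {α : Type*} [DecidableEq α] {M : Matroid α} [M.Finite] {G : Finset α}

/-- The small witnesses when `|P₂| = 3` (`L₀ = ∅`, `|P₃| = 1`): pattern (α) — two side points and a free spine point. -/
theorem deg_wit_case_p2_three {w₀ x : α} {R₁ : Finset α} {c₂ c₃ : α} {B : Finset α} {z : α}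
    (hd : (gr M \ G).card = 2) (hk : kColoops M G = 1) (hfat : (fatClosures M 5 G 2).card ≤ 1) (hR₁2 : rkN M R₁ = 2)
    (hR₁3 : 3 ≤ R₁.card) (hcop : rkN M (insert w₀ (insert x R₁)) ≤ 3)
    (hcover : ∀ e ∈ (G \ coloops M G) \ {w₀, x}, e ∈ clF M (insert c₂ R₁) ∨ e ∈ clF M (insert c₃ R₁))
    (hnd₂ : 3 ≤ rkN M (((G \ coloops M G) \ {w₀, x}).filter (fun e => e ∈ clF M (insert c₂ R₁) ∧ e ∉ clF M R₁)))
    (hdeg₃ : rkN M (((G \ coloops M G) \ {w₀, x}).filter (fun e => e ∈ clF M (insert c₃ R₁) ∧ e ∉ clF M R₁)) ≤ 2)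
    {V P W Mset P₃ M' L₀ P₂ Aset Lset : Finset α} (hV : V = (G \ coloops M G) \ {w₀, x})
    (hP : P = (insert z B \ coloops M G).erase w₀) (hW : W = (G \ insert z B).erase x)
    (hMset : Mset = V.filter (fun e => e ∈ clF M (insert c₃ R₁) ∧ e ∉ clF M R₁))
    (hP₃ : P₃ = P.filter (fun e => e ∈ Mset)) (hM' : M' = W.filter (fun e => e ∈ Mset))
    (hL₀ : L₀ = P.filter (fun e => e ∈ clF M R₁))
    (hP₂ : P₂ = P.filter (fun e => e ∈ clF M (insert c₂ R₁) ∧ e ∉ clF M R₁))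
    (hAset : Aset = V.filter (fun e => e ∈ clF M (insert c₂ R₁) ∧ e ∉ clF M R₁))
    (hLset : Lset = V.filter (fun e => e ∈ clF M R₁)) {y₃ : α} (hVg : V ⊆ gr M) (hPV : P ⊆ V) (hP4 : P.card = 4)
    (hM3 : 3 ≤ Mset.card) (hM2 : 1 < Mset.card) (hP₃2 : P₃.card ≤ 2) (hMsplit : Mset.card = P₃.card + M'.card)
    (hM'1 : 1 ≤ M'.card) (hy₃ : y₃ ∈ W ∧ y₃ ∈ Mset) (hy₃side : y₃ ∈ clF M (insert c₃ R₁) ∧ y₃ ∉ clF M R₁)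
    (hL₀2 : L₀.card ≤ 2) (hπ₂3 : (P.filter (fun e => e ∈ clF M (insert c₂ R₁))).card ≤ 3)
    (hL₀P₂ : L₀.card + P₂.card ≤ 3) (hsplit : L₀.card + P₂.card + P₃.card = 4) (hL3 : 3 ≤ Lset.card)
    (hLW : ∀ e ∈ Lset, e ∉ L₀ → e ∈ W) (hLM : ∀ s ∈ Lset, ∀ s' ∈ Lset, s ≠ s' → s ∈ clF M Mset → s' ∉ clF M Mset)
    (hAM : ∀ e ∈ Aset, e ∉ clF M Mset)
    (hpencil : ∀ c ∈ P₂, ∀ a ∈ P, ∀ b ∈ P, c ≠ a → c ≠ b → a ≠ b → rkN M (insert w₀ (insert x {c, a})) ≤ 3 → rkN M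
      (insert w₀ (insert x {c, b})) ≤ 3 → False)
    (htwo : P₃.card ≤ 1 → ∃ y₃' ∈ W, y₃' ≠ y₃ ∧ (y₃' ∈ clF M (insert c₃ R₁) ∧ y₃' ∉ clF M R₁))
    (hfreeL : L₀.card ≤ 1 → ∀ s ∈ W, s ∈ clF M R₁ → s ∉ clF M Mset → (∀ c ∈ P₂, ∀ c' ∈ P₂, c ≠ c' → s ∈ clF M {c,
      c'} → rkN M (insert w₀ (insert x {c, c'})) ≤ 3 → 4 ≤ rkN M ({c, c'} ∪ Mset)) → s ∉ clF M Mset ∧ ∀ a ∈ P, ∀ b ∈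
      P, a ≠ b → s ∈ clF M {a, b} → rkN M (insert w₀ (insert x {a, b})) ≤ 3 → 4 ≤ rkN M ({a, b} ∪ Mset))
    (hA3 : 3 ≤ Aset.card)
    (hsingM : (¬ (4 ≤ rkN M (insert w₀ (insert x Mset)) ∧ ∃ a ∈ P, ∃ b ∈ P, a ≠ b ∧ a ∈ clF M Mset ∧ b ∈ clF M
      Mset)) → ∀ y ∈ W, (y ∈ clF M (insert c₃ R₁) ∧ y ∉ clF M R₁) → ∀ a ∈ P, ∀ b ∈ P, a ≠ b → y ∈ clF M {a, b} → rkN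
      M (insert w₀ (insert x {a, b})) ≤ 3)
    (hL₀1 : L₀.card ≤ 1) (hLWcard : Lset.card ≤ (Lset.filter (fun e => e ∈ W)).card + L₀.card)
    (hLline : ∀ c ∈ P₂, ∀ c' ∈ P, c ≠ c' → ∀ s ∈ Lset, ∀ s' ∈ Lset, s ≠ s' → s ∈ clF M {c, c'} → s' ∉ clF M {c, c'})
    (hP₂2 : 2 ≤ P₂.card) (hP₂3 : 3 ≤ P₂.card) :
    ∃ U V E : Finset α, U ⊆ (G \ insert z B).erase x ∧ (∀ y ∈ U, y ∈ clF M (insert c₃ R₁) ∧ y ∉ clF M R₁) ∧ V ⊆ (G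
      \ insert z B).erase x ∧ (∀ f ∈ V, f ∉ clF M (((G \ coloops M G) \ {w₀, x}).filter (fun e => e ∈ clF M (insert
      c₃ R₁) ∧ e ∉ clF M R₁)) ∧ ∀ a ∈ (insert z B \ coloops M G).erase w₀, ∀ b ∈ (insert z B \ coloops M G).erase
      w₀, a ≠ b → f ∈ clF M {a, b} → rkN M (insert w₀ (insert x {a, b})) ≤ 3 → 4 ≤ rkN M ({a, b} ∪ (((G \ coloops M
      G) \ {w₀, x}).filter (fun e => e ∈ clF M (insert c₃ R₁) ∧ e ∉ clF M R₁)))) ∧ E ⊆ (G \ insert z B).erase x ∧ (∀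
      y ∈ E, ∀ a ∈ (insert z B \ coloops M G).erase w₀, ∀ b ∈ (insert z B \ coloops M G).erase w₀, a ≠ b → y ∈ clF M
      {a, b} → rkN M (insert w₀ (insert x {a, b})) ≤ 3) ∧ ((¬ (4 ≤ rkN M (insert w₀ (insert x (((G \ coloops M G) \
      {w₀, x}).filter (fun e => e ∈ clF M (insert c₃ R₁) ∧ e ∉ clF M R₁)))) ∧ ∃ a ∈ (insert z B \ coloops M G).erase
      w₀, ∃ b ∈ (insert z B \ coloops M G).erase w₀, a ≠ b ∧ a ∈ clF M (((G \ coloops M G) \ {w₀, x}).filter (fun e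
      => e ∈ clF M (insert c₃ R₁) ∧ e ∉ clF M R₁)) ∧ b ∈ clF M (((G \ coloops M G) \ {w₀, x}).filter (fun e => e ∈
      clF M (insert c₃ R₁) ∧ e ∉ clF M R₁))) ∧ U.card = 2 ∧ V.card = 1 ∧ 2 ≤ E.card) ∨ (U.card = 1 ∧ V.card = 3 ∧ 2
      ≤ E.card) ∨ (U.card = 2 ∧ V.card = 2 ∧ 1 ≤ E.card) ∨ (U.card = 1 ∧ V.card = 2 ∧ 3 ≤ E.card)) := by
  subst hV hP hW hMset hP₃ hM' hL₀ hP₂ hAset hLset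
  set V := (G \ coloops M G) \ {w₀, x} with hV
  set P := (insert z B \ coloops M G).erase w₀ with hP
  set W := (G \ insert z B).erase x with hW
  set Mset := V.filter (fun e => e ∈ clF M (insert c₃ R₁) ∧ e ∉ clF M R₁) with hMset
  set P₃ := P.filter (fun e => e ∈ Mset) with hP₃
  set M' := W.filter (fun e => e ∈ Mset) with hM'
  set L₀ := P.filter (fun e => e ∈ clF M R₁) with hL₀
  set P₂ := P.filter (fun e => e ∈ clF M (insert c₂ R₁) ∧ e ∉ clF M R₁) with hP₂
  set Aset := V.filter (fun e => e ∈ clF M (insert c₂ R₁) ∧ e ∉ clF M R₁) with hAset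
  set Lset := V.filter (fun e => e ∈ clF M R₁) with hLset
  have _u := hd
  have _u := hk
  have _u := hfat
  have _u := hR₁2
  have _u := hR₁3
  have _u := hcop
  have _u := hnd₂
  have _u := hdeg₃
  have _u := hP4
  have _u := hM3
  have _u := hM2
  have _u := hP₃2
  have _u := hMsplit
  have _u := hM'1
  have _u := hL₀2
  have _u := hπ₂3
  have _u := hL₀P₂
  have _u := hsplit
  have _u := hL3
  have _u := hA3
  have _u := hL₀1
  have _u := hLWcard
  have _u := hP₂2
  have _u := hP₂3
  have hL₀e : L₀ = ∅ := Finset.card_eq_zero.1 (by omega)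
  have hnoL₀ : ∀ a, a ∉ L₀ := fun a ha => by rw [hL₀e] at ha; exact Finset.notMem_empty _ ha
  have hLWall : ∀ e ∈ Lset, e ∈ W := fun e he => hLW e he (hnoL₀ e)
  obtain ⟨y₃', hy₃'W, hyy, hy₃'side⟩ := htwo (by omega)
  have hUc : ({y₃, y₃'} : Finset α).card = 2 := Finset.card_pair (Ne.symm hyy)
  have hUW : ({y₃, y₃'} : Finset α) ⊆ W :=
    Finset.insert_subset hy₃.1 (Finset.singleton_subset_iff.2 hy₃'W)
  have hUside : ∀ y ∈ ({y₃, y₃'} : Finset α), y ∈ clF M (insert c₃ R₁) ∧ y ∉ clF M R₁ := by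
    intro y hy
    rw [Finset.mem_insert, Finset.mem_singleton] at hy
    rcases hy with rfl | rfl
    · exact hy₃side
    · exact hy₃'side
  -- the line of `M` is not a basis line: its only basis point is the side basis point
  have hNCL : ¬ (4 ≤ rkN M (insert w₀ (insert x Mset)) ∧
      ∃ a ∈ P, ∃ b ∈ P, a ≠ b ∧ a ∈ clF M Mset ∧ b ∈ clF M Mset) := by
    rintro ⟨-, a₀, ha₀P, b₀, hb₀P, hab₀, ha₀M, hb₀M⟩
    have hside : ∀ t ∈ P, t ∈ clF M Mset → t ∈ Mset := by
      intro t ht htM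
      rcases spine_or_plane_or_side hcover (hPV ht) with h | ⟨h2, hL⟩ | h
      · exact absurd (Finset.mem_filter.2 ⟨ht, h⟩) (hnoL₀ t)
      · exact absurd htM (hAM t (Finset.mem_filter.2 ⟨hPV ht, h2, hL⟩))
      · exact Finset.mem_filter.2 ⟨hPV ht, h⟩
    have : ({a₀, b₀} : Finset α) ⊆ P₃ := by
      intro t ht
      rw [Finset.mem_insert, Finset.mem_singleton] at ht
      rcases ht with rfl | rfl
      · exact Finset.mem_filter.2 ⟨ha₀P, hside _ ha₀P ha₀M⟩
      · exact Finset.mem_filter.2 ⟨hb₀P, hside _ hb₀P hb₀M⟩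
    have := Finset.card_le_card this
    rw [Finset.card_pair hab₀] at this
    omega
  have hEsing : ∀ y ∈ ({y₃, y₃'} : Finset α), ∀ a' ∈ P, ∀ b ∈ P, a' ≠ b → y ∈ clF M {a', b} →
      rkN M (insert w₀ (insert x {a', b})) ≤ 3 := fun y hy => hsingM hNCL y (hUW hy) (hUside y hy)
  -- a free spine point (as in `exists_side_and_free_deg`)
  have hfree : ∃ f ∈ W, f ∉ clF M Mset ∧ ∀ a ∈ P, ∀ b ∈ P, a ≠ b → f ∈ clF M {a, b} →
      rkN M (insert w₀ (insert x {a, b})) ≤ 3 → 4 ≤ rkN M ({a, b} ∪ Mset) := by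
    by_cases hex : ∃ d ∈ P₂, ∃ d' ∈ P₂, d ≠ d' ∧ rkN M (insert w₀ (insert x {d, d'})) ≤ 3
    · obtain ⟨d, hd, d', hd', hdd', hcls⟩ := hex
      have hdg : d ∈ gr M := hVg (hPV (Finset.mem_filter.1 hd).1)
      have hd'g : d' ∈ gr M := hVg (hPV (Finset.mem_filter.1 hd').1)
      obtain ⟨s, hsL, hsM, hsX⟩ : ∃ s ∈ Lset, s ∉ clF M Mset ∧ s ∉ clF M {d, d'} := by
        by_contra hcon
        push Not at hcon
        obtain ⟨s₁, hs₁, s₂, hs₂, s₃, hs₃, h12, h13, h23⟩ := Finset.two_lt_card.1 (by omega : 2 < Lset.card)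
        rcases Classical.em (s₁ ∈ clF M Mset) with h1 | h1
        · rcases Classical.em (s₂ ∈ clF M Mset) with h2 | h2
          · exact hLM s₁ hs₁ s₂ hs₂ h12 h1 h2
          · rcases Classical.em (s₃ ∈ clF M Mset) with h3 | h3
            · exact hLM s₁ hs₁ s₃ hs₃ h13 h1 h3
            · exact hLline d hd d' (Finset.mem_filter.1 hd').1 hdd' s₂ hs₂ s₃ hs₃ h23 (hcon s₂ hs₂ h2)
                (hcon s₃ hs₃ h3)
        · rcases Classical.em (s₂ ∈ clF M Mset) with h2 | h2
          · rcases Classical.em (s₃ ∈ clF M Mset) with h3 | h3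
            · exact hLM s₂ hs₂ s₃ hs₃ h23 h2 h3
            · exact hLline d hd d' (Finset.mem_filter.1 hd').1 hdd' s₁ hs₁ s₃ hs₃ h13 (hcon s₁ hs₁ h1)
                (hcon s₃ hs₃ h3)
          · exact hLline d hd d' (Finset.mem_filter.1 hd').1 hdd' s₁ hs₁ s₂ hs₂ h12 (hcon s₁ hs₁ h1)
              (hcon s₂ hs₂ h2)
      refine ⟨s, hLWall s hsL, hfreeL hL₀1 s (hLWall s hsL) (Finset.mem_filter.1 hsL).2 hsM ?_⟩
      intro e he e' he' hee' hsee hcls'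
      exfalso
      have hkey : ({e, e'} : Finset α) = {d, d'} := by
        by_contra hneq
        rcases Classical.em (e = d) with rfl | hed
        · rcases Classical.em (e' = d') with rfl | hed'
          · exact hneq rfl
          · exact hpencil e hd d' (Finset.mem_filter.1 hd').1 e' (Finset.mem_filter.1 he').1 hdd' hee'
              (Ne.symm hed') hcls hcls'
        · rcases Classical.em (e = d') with rfl | hed'
          · rcases Classical.em (e' = d) with rfl | he'd
            · exact hneq (Finset.pair_comm _ _)
            · rw [Finset.pair_comm] at hcls
              exact hpencil e hd' d (Finset.mem_filter.1 hd).1 e' (Finset.mem_filter.1 he').1 (Ne.symm hdd')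
                hee' (Ne.symm he'd) hcls hcls'
          · rcases Classical.em (e' = d) with rfl | he'd
            · rw [Finset.pair_comm] at hcls'
              exact hpencil e' hd e (Finset.mem_filter.1 he).1 d' (Finset.mem_filter.1 hd').1 (Ne.symm hee')
                hdd' (fun h => hed' h) hcls' hcls
            · rcases Classical.em (e' = d') with rfl | he'd'
              · rw [Finset.pair_comm] at hcls hcls'
                exact hpencil e' hd' e (Finset.mem_filter.1 he).1 d (Finset.mem_filter.1 hd).1 (Ne.symm hee')
                  (Ne.symm hdd') (fun h => hed h) hcls' hcls
              · have hsub : ({e, e', d, d'} : Finset α) ⊆ P₂ := by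
                  intro t ht
                  simp only [Finset.mem_insert, Finset.mem_singleton] at ht
                  rcases ht with rfl | rfl | rfl | rfl
                  · exact he
                  · exact he'
                  · exact hd
                  · exact hd'
                have h4 : ({e, e', d, d'} : Finset α).card = 4 := by
                  rw [Finset.card_insert_of_notMem, Finset.card_insert_of_notMem, Finset.card_pair hdd']
                  · simp only [Finset.mem_insert, Finset.mem_singleton, not_or]
                    exact ⟨he'd, he'd'⟩
                  · simp only [Finset.mem_insert, Finset.mem_singleton, not_or]
                    exact ⟨hee', hed, hed'⟩
                have := Finset.card_le_card hsub
                omega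
      rw [hkey] at hsee
      exact hsX hsee
    · push Not at hex
      obtain ⟨s₁, hs₁, s₂, hs₂, h12⟩ := Finset.one_lt_card.1 (by omega : 1 < Lset.card)
      by_cases hsM : s₁ ∈ clF M Mset
      · have hs₂M : s₂ ∉ clF M Mset := hLM s₁ hs₁ s₂ hs₂ h12 hsM
        refine ⟨s₂, hLWall s₂ hs₂, hfreeL hL₀1 s₂ (hLWall s₂ hs₂) (Finset.mem_filter.1 hs₂).2 hs₂M ?_⟩
        intro d hd d' hd' hdd' _ hcls
        exact absurd hcls (not_le.2 (hex d hd d' hd' hdd'))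
      · refine ⟨s₁, hLWall s₁ hs₁, hfreeL hL₀1 s₁ (hLWall s₁ hs₁) (Finset.mem_filter.1 hs₁).2 hsM ?_⟩
        intro d hd d' hd' hdd' _ hcls
        exact absurd hcls (not_le.2 (hex d hd d' hd' hdd'))
  obtain ⟨f, hfW, hffree⟩ := hfree
  refine ⟨{y₃, y₃'}, {f}, {y₃, y₃'}, hUW, hUside, Finset.singleton_subset_iff.2 hfW, ?_, hUW, hEsing,
    Or.inl ⟨hNCL, hUc, Finset.card_singleton _, by rw [hUc]⟩⟩
  intro g hg
  rw [Finset.mem_singleton] at hg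
  subst hg
  exact hffree

end PercRepro.Shadow
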